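import Literature.AlgebraicGeometry.Motives.LefschetzClassesProducts
import Literature.AlgebraicGeometry.Motives.LefschetzClassesIsogeny
import Literature.AlgebraicGeometry.Motives.DivisorClassesPowersOfCurve
import HarnessLib

/-!
# All classes on `Eᵍ`, and on abelian varieties isogenous to `Eᵍ`, are Lefschetz classes
# when the endomorphisms of `E` span `End H¹(E)`

Assembly of the formal part of the Lenstra–Zarhin / Tate argument for the named fact
`LenstraZarhin1993_supersingular_lefschetzClasses_eq_top` (`Motives/SupersingularAbelianVariety`;
Lenstra–Zarhin 1993, §1, p. 179; Tate 1966, Thm. 4), for a Weil cohomology theory `W`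
(Kleiman 1968, §1.2) over an arbitrary field `k`:

* `WeilCohomology.lefschetzClasses_powSucc_eq_top`: for a one-dimensional abelian variety `E`
  whose endomorphisms `f*|H¹(E)` (`f : E → E` a `k`-morphism) span `End_K H¹(E)`, every class
  in every `H²ʳ(Eᵐ⁺¹)` is a Lefschetz class (divisor classes span `H²(Eᵐ⁺¹)`,
  `algebraicClasses_powSucc_one_eq_top`, and the exterior-algebra step
  `lefschetzClasses_eq_top_of_algebraicClasses_one_eq_top`);
* `WeilCohomology.lefschetzClasses_eq_top_of_isIsogenous_powSucc`: hence the same for every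
  abelian variety `A` isogenous to such a power `Eᵐ⁺¹` (`lefschetzClasses_eq_top_of_isIsogenous`,
  quasi-inverses of isogenies).

What this leaves of the named fact (a supersingular `A` over an algebraically closed `k`,
`A ⊗ k̄ ∼ Eᵍ` with `E[p](k̄) = 0`): (1) the spanning hypothesis for a supersingular elliptic
curve — Deuring's theorem `rank End E = 4`, `End⁰ E` a quaternion algebra, with the faithfulness
of `End⁰ E ⊗ K → End_K H¹(E)` — and (2) the transport of `E` and of the isogeny from
`k̄ = AlgebraicClosure k` back to the algebraically closed field `k`.

## References

* [LenstraZarhin1993] H. W. Lenstra, Jr., Yu. G. Zarhin, Advances in Number Theory (1993), §1,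
  p. 179.
* [Tate1966Endomorphisms] J. Tate, Invent. Math. 2 (1966), Thm. 4.
* [Kleiman1968] S. Kleiman, *Algebraic cycles and the Weil conjectures* (1968), §1.2.
-/

noncomputable section

universe u v

open CategoryTheory AlgebraicGeometry

namespace Literature.AlgebraicGeometry.Motives

namespace WeilCohomology

variable {k : Type u} [Field k] {K : Type v} [Field K] [CharZero K] (W : WeilCohomology k K)

/-- **All classes on the powers `Eᵐ⁺¹` are Lefschetz classes** when `E` is a one-dimensional
abelian variety whose endomorphisms span `End_K H¹(E)` (Tate 1966, Thm. 4, and Lenstra–Zarhin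
1993, §1, for `E` supersingular: `H²(Eᵍ)` is spanned by divisor classes and `H²ʳ = ⋀²ʳ H¹` by
their products). [cite: LenstraZarhin1993, §1 p. 179] -/
theorem lefschetzClasses_powSucc_eq_top (E : AbelianVariety k) (hE : E.dim = 1)
    (hspan : Submodule.span K (Set.range fun f : E.X ⟶ E.X ↦ W.pullback f 1) = ⊤) (m r : ℕ) :
    W.lefschetzClasses (E.powSucc m).X r = ⊤ :=
  W.lefschetzClasses_eq_top_of_algebraicClasses_one_eq_top (E.powSucc m)
    (W.algebraicClasses_powSucc_one_eq_top E hE hspan m) r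

/-- **All classes on an abelian variety isogenous to a power `Eᵐ⁺¹` are Lefschetz classes**
when the endomorphisms of the one-dimensional `E` span `End_K H¹(E)`: pull-back along the
isogeny is onto (`lefschetzClasses_eq_top_of_isIsogenous`) and `Eᵐ⁺¹` has only Lefschetz
classes (`lefschetzClasses_powSucc_eq_top`). For `k` algebraically closed of characteristic `p`,
`A` supersingular and `E` a supersingular elliptic curve this is Lenstra–Zarhin 1993, §1, p. 179,
up to Deuring's theorem on `End E`. [cite: LenstraZarhin1993, §1 p. 179] -/
theorem lefschetzClasses_eq_top_of_isIsogenous_powSucc (A E : AbelianVariety k) (hE : E.dim = 1)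
    (hspan : Submodule.span K (Set.range fun f : E.X ⟶ E.X ↦ W.pullback f 1) = ⊤) {m : ℕ}
    (hA : AbelianVariety.IsIsogenous A (E.powSucc m)) (r : ℕ) :
    W.lefschetzClasses A.X r = ⊤ :=
  W.lefschetzClasses_eq_top_of_isIsogenous hA r (W.lefschetzClasses_powSucc_eq_top E hE hspan m r)

end WeilCohomology

end Literature.AlgebraicGeometry.Motives

end
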